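import Summits.CriticalPhenomena.CardyFormulaZ2.Theorems.CardyBoundaryCoulombGasBoundaryDefectGaussianRStubRigidityOfLocalLawsPart2

/-!
# Stub `stub_rigidity_of_local_laws` of line `rainbow-monomials-in-excursion-kernels` — Part 3:
# rigidity from the local laws, PER LEG FAMILY, conditional on TRANSPORT and REAL

Crux `BoundaryDefectGaussianR` (stmt-CriticalPhenomena-14132). `s3_rigidityOfTransportFamily`: for
one leg family `(k, L, j)` with `L j = Σ_{i ≠ j} L i`,

  `TRANSPORT(k,L,j) → REAL(k,L,j) → POINT_TRANSPORT(k,L,j) → CLUSTER_LOCALITY(k,L,j) → RIGIDITY(k,L,j)`,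

where the last three are the skeleton's Stub 1 / Stub 2 / Stub 3-conclusion texts with their
leading `∀ k L j, L j = … →` removed, and the two NEW hypotheses (typed by this worker; they are
NOT consequences of the two local laws, which both assume positivity) are

* **REAL** (realisability): for a rectilinear Jordan domain discretised along `δ_n → 0⁺`, for
  every macroscopic scale `r > 0`, eventually in `n`, every injective admissible configuration
  whose points are `r/δ_n`-flat and pairwise `r/δ_n`-separated has `0 < ‖Zins‖/‖Z‖` (the
  dictionary-level fact `|Zins| = #{rainbow configurations} > 0` of `CollarLegModel`);
* **TRANSPORT** (admissible transport paths): for a rectilinear marked domain with flat marks,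
  positively oriented at the sink mark, and admissible injective `p_n → marks`: there are bottom-row
  anchors `a_n` with flat bottom-type environments of radius `s₀/δ_n`, an admissible scale `r₀` and
  a count `N` such that for all `0 < ρ ≤ r ≤ r₀`, eventually, for EVERY family of strictly
  increasing, `r/δ_n`-separated slots `x` within `s₀/δ_n`, a path of configurations from `p_n` to
  the cluster `i ↦ a_n + (x i, 0)` exists, all of whose configurations are injective, admissible,
  `ρ/(4δ_n)`-flat at every point and `r/δ_n`-separated, whose steps are unit slides (tag `true`)
  or `ρ/δ_n`-jumps with the other points `r/δ_n`-flat (tag `false`), with `T·δ_n ≤ N` steps and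
  `≤ N` jumps — exactly the hypotheses under which Stub 1 (a) at scale `ρ/4`, Stub 1 (b) at `(r, ρ)`
  and REAL at scale `ρ/4` apply.

Proof: `s3_rigidityAbstract` (Part 2) instantiated — `Adm V c := IsAdmissible ι(c) V`,
`P V c := ‖Zins V ι(c)‖/‖Z V‖`, `F V c := log P − Λ_V(c)` — by definitional unfolding.

Also here (registered sub-goal `s3_dsucc_iterate_dist`, one of the geometry-free walk lemmas the
TRANSPORT hypothesis rests on; the others are Parts 5–6): `g` steps of the boundary walk `dsucc` of
`CollarLegModel` move the vertex by at most `g` in each coordinate, so index gaps along the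
boundary cycle dominate lattice `ℓ∞`-distances of insertion points.
-/

noncomputable section

open Filter Topology

namespace Summit.CriticalPhenomena.CardyFormulaZ2.Cruxes.BoundaryDefectGaussianR.RainbowMonomialsInExcursionKernels

/-- **Rigidity from the local laws, per leg family, conditional on transport paths and
realisability.** For a leg family `(k, L, j)` with `L j = Σ_{i≠j} L i`:
TRANSPORT → REAL → POINT TRANSPORT → CLUSTER LOCALITY → RIGIDITY (texts: module docstring; the
last three are the skeleton's, specialised to the family). [folklore] -/
theorem s3_rigidityOfTransportFamily :
    ∀ (k : ℕ) (L : Fin k → ℕ) (j : Fin k), L j = ∑ i ∈ Finset.univ.erase j, L i → (∀ (D :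
    Literature.Probability.RandomPlanarGeometry.MarkedDomain k), (∃ S : Finset (ℂ × ℂ), (∀ q ∈ S, q.1.re =
    q.2.re ∨ q.1.im = q.2.im) ∧ frontier D.carrier ⊆ ⋃ q ∈ S, segment ℝ q.1 q.2) → (∀ i, (∃ r : ℝ, 0 < r ∧
    ((∀ z ∈ frontier D.carrier, dist z (D.pt i) < r → z.im = (D.pt i).im) ∨ (∀ z ∈ frontier D.carrier, dist
    z (D.pt i) < r → z.re = (D.pt i).re)))) → (∃ τ : ℂ, ‖τ‖ = 1 ∧ (∃ ε : ℝ, 0 < ε ∧ ∀ t ∈ Set.Ioo (D.mark j)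
    (D.mark j + ε), ∃ s : ℝ, 0 < s ∧ D.boundary t = D.pt j + (s : ℂ) * τ) ∧ (∃ ε : ℝ, 0 < ε ∧ ∀ s ∈ Set.Ioo
    (0 : ℝ) ε, D.pt j + (s : ℂ) * (τ * Complex.I) ∈ D.carrier)) → ∀ (δ : ℕ → ℝ), (∀ n, 0 < δ n) →
    Filter.Tendsto δ Filter.atTop (nhds 0) → ∀ (V : ℕ → Finset (ℤ × ℤ)), (∀ n, ∀ v : ℤ × ℤ, v ∈ V n ↔
    (((v).1 : ℂ) * ((δ n : ℝ) : ℂ) + ((v).2 : ℂ) * ((δ n : ℝ) : ℂ) * Complex.I) ∈ closure D.carrier) → ∀ (p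
    : ℕ → Fin k → ℤ × ℤ), (∀ n, Function.Injective ((p) n)) → (∀ i, Filter.Tendsto (fun n ↦ ((((p) n i).1 :
    ℂ) * ((δ n : ℝ) : ℂ) + (((p) n i).2 : ℂ) * ((δ n : ℝ) : ℂ) * Complex.I)) Filter.atTop (nhds (D.pt i))) →
    (∀ n, Literature.Probability.LatticeModels.CollarLegModel.LegInsertionData.IsAdmissible
    (⟨(Finset.univ.erase j).image ((p) n), fun v ↦ ∑ b ∈ (Finset.univ.erase j).filter (fun b ↦ ((p) n) b =
    v), L b, ((p) n) j⟩ : Literature.Probability.LatticeModels.CollarLegModel.LegInsertionData) (V n)) → ∃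
    (a : ℕ → ℤ × ℤ) (s₀ r₀ : ℝ) (N : ℕ), 0 < s₀ ∧ 0 < r₀ ∧ (∀ᶠ n in Filter.atTop, ∀ v : ℤ × ℤ, (((((v).1 -
    (a n).1) ^ 2 + ((v).2 - (a n).2) ^ 2 : ℤ) : ℝ)) ≤ (s₀ / δ n) ^ 2 → (v ∈ V n ↔ 0 ≤ v.2 - (a n).2)) ∧ ∀ (r
    : ℝ), 0 < r → r ≤ r₀ → ∀ (ρ : ℝ), 0 < ρ → ρ ≤ r → ∀ᶠ n in Filter.atTop, ∀ (x : Fin k → ℤ), StrictMono x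
    → (∀ i₁ i₂ : Fin k, i₁ ≠ i₂ → (r / δ n) ^ 2 ≤ (((x i₁ - x i₂) ^ 2 : ℤ) : ℝ)) → (∀ i, (((x i) ^ 2 : ℤ) :
    ℝ) ≤ (s₀ / δ n) ^ 2) → ∃ (T : ℕ) (q : ℕ → Fin k → ℤ × ℤ) (σ : ℕ → Bool), q 0 = p n ∧ (q T = fun i ↦ ((a
    n).1 + x i, (a n).2)) ∧ (T : ℝ) * δ n ≤ N ∧ ((Finset.range T).filter (fun t ↦ σ t = false)).card ≤ N ∧
    (∀ t, t ≤ T → Function.Injective (q t) ∧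
    Literature.Probability.LatticeModels.CollarLegModel.LegInsertionData.IsAdmissible (⟨(Finset.univ.erase
    j).image (q t), fun v ↦ ∑ b ∈ (Finset.univ.erase j).filter (fun b ↦ (q t) b = v), L b, (q t) j⟩ :
    Literature.Probability.LatticeModels.CollarLegModel.LegInsertionData) (V n) ∧ (∀ i, (∃ d : ℤ × ℤ, (d =
    (1, 0) ∨ d = (-1, 0) ∨ d = (0, 1) ∨ d = (0, -1)) ∧ ∀ v : ℤ × ℤ, (((((v).1 - (q t i).1) ^ 2 + ((v).2 - (q
    t i).2) ^ 2 : ℤ) : ℝ)) ≤ (ρ / 4 / δ n) ^ 2 → (v ∈ V n ↔ 0 ≤ (v.1 - (q t i).1) * d.1 + (v.2 - (q t i).2)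
    * d.2))) ∧ (∀ i₁ i₂ : Fin k, i₁ ≠ i₂ → (r / δ n) ^ 2 ≤ ((((((q t) i₁).1 - ((q t) i₂).1) ^ 2 + (((q t)
    i₁).2 - ((q t) i₂).2) ^ 2 : ℤ) : ℝ)))) ∧ (∀ t, t < T → (σ t = true → ∃ (i : Fin k) (τ : ℤ × ℤ), (τ = (1,
    0) ∨ τ = (-1, 0) ∨ τ = (0, 1) ∨ τ = (0, -1)) ∧ q (t + 1) = Function.update (q t) i (q t i + τ)) ∧ (σ t =
    false → ∃ (i : Fin k) (q' : ℤ × ℤ), q (t + 1) = Function.update (q t) i q' ∧ (∀ i', i' ≠ i → (∃ d : ℤ ×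
    ℤ, (d = (1, 0) ∨ d = (-1, 0) ∨ d = (0, 1) ∨ d = (0, -1)) ∧ ∀ v : ℤ × ℤ, (((((v).1 - (q t i').1) ^ 2 +
    ((v).2 - (q t i').2) ^ 2 : ℤ) : ℝ)) ≤ (r / δ n) ^ 2 → (v ∈ V n ↔ 0 ≤ (v.1 - (q t i').1) * d.1 + (v.2 -
    (q t i').2) * d.2))) ∧ (((((q').1 - (q t i).1) ^ 2 + ((q').2 - (q t i).2) ^ 2 : ℤ) : ℝ)) ≤ (ρ / δ n) ^
    2))) → (∀ (D : Literature.Probability.RandomPlanarGeometry.JordanDomain), (∃ S : Finset (ℂ × ℂ), (∀ q ∈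
    S, q.1.re = q.2.re ∨ q.1.im = q.2.im) ∧ frontier D.carrier ⊆ ⋃ q ∈ S, segment ℝ q.1 q.2) → ∀ (r : ℝ), 0
    < r → ∀ (δ : ℕ → ℝ), (∀ n, 0 < δ n) → Filter.Tendsto δ Filter.atTop (nhds 0) → ∀ (V : ℕ → Finset (ℤ ×
    ℤ)), (∀ n, ∀ v : ℤ × ℤ, v ∈ V n ↔ (((v).1 : ℂ) * ((δ n : ℝ) : ℂ) + ((v).2 : ℂ) * ((δ n : ℝ) : ℂ) *
    Complex.I) ∈ closure D.carrier) → ∀ᶠ n in Filter.atTop, ∀ (p : Fin k → ℤ × ℤ), Function.Injective p →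
    Literature.Probability.LatticeModels.CollarLegModel.LegInsertionData.IsAdmissible (⟨(Finset.univ.erase
    j).image (p), fun v ↦ ∑ b ∈ (Finset.univ.erase j).filter (fun b ↦ (p) b = v), L b, (p) j⟩ :
    Literature.Probability.LatticeModels.CollarLegModel.LegInsertionData) (V n) → (∀ i', (∃ d : ℤ × ℤ, (d =
    (1, 0) ∨ d = (-1, 0) ∨ d = (0, 1) ∨ d = (0, -1)) ∧ ∀ v : ℤ × ℤ, (((((v).1 - (p i').1) ^ 2 + ((v).2 - (p
    i').2) ^ 2 : ℤ) : ℝ)) ≤ (r / δ n) ^ 2 → (v ∈ V n ↔ 0 ≤ (v.1 - (p i').1) * d.1 + (v.2 - (p i').2) *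
    d.2))) → (∀ i₁ i₂ : Fin k, i₁ ≠ i₂ → (r / δ n) ^ 2 ≤ ((((((p) i₁).1 - ((p) i₂).1) ^ 2 + (((p) i₁).2 -
    ((p) i₂).2) ^ 2 : ℤ) : ℝ))) → 0 < (‖Literature.Probability.LatticeModels.CollarLegModel.Zins (V n)
    (⟨(Finset.univ.erase j).image (p), fun v ↦ ∑ b ∈ (Finset.univ.erase j).filter (fun b ↦ (p) b = v), L b,
    (p) j⟩ : Literature.Probability.LatticeModels.CollarLegModel.LegInsertionData)‖ /
    ‖(Literature.Probability.LatticeModels.CollarLegModel.ofDomain (V n)).Z‖)) → ((∀ (D :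
    Literature.Probability.RandomPlanarGeometry.JordanDomain), (∃ S : Finset (ℂ × ℂ), (∀ q ∈ S, q.1.re =
    q.2.re ∨ q.1.im = q.2.im) ∧ frontier D.carrier ⊆ ⋃ q ∈ S, segment ℝ q.1 q.2) → ∀ (r ε : ℝ), 0 < r → 0 <
    ε → ∀ (δ : ℕ → ℝ), (∀ n, 0 < δ n) → Filter.Tendsto δ Filter.atTop (nhds 0) → ∀ (V : ℕ → Finset (ℤ × ℤ)),
    (∀ n, ∀ v : ℤ × ℤ, v ∈ V n ↔ (((v).1 : ℂ) * ((δ n : ℝ) : ℂ) + ((v).2 : ℂ) * ((δ n : ℝ) : ℂ) * Complex.I)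
    ∈ closure D.carrier) → ∀ᶠ n in Filter.atTop, ∀ (p : Fin k → ℤ × ℤ) (i : Fin k) (τ : ℤ × ℤ), (τ = (1, 0)
    ∨ τ = (-1, 0) ∨ τ = (0, 1) ∨ τ = (0, -1)) → Function.Injective p → Function.Injective (Function.update p
    i (p i + τ)) → Literature.Probability.LatticeModels.CollarLegModel.LegInsertionData.IsAdmissible
    (⟨(Finset.univ.erase j).image (p), fun v ↦ ∑ b ∈ (Finset.univ.erase j).filter (fun b ↦ (p) b = v), L b,
    (p) j⟩ : Literature.Probability.LatticeModels.CollarLegModel.LegInsertionData) (V n) →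
    Literature.Probability.LatticeModels.CollarLegModel.LegInsertionData.IsAdmissible (⟨(Finset.univ.erase
    j).image ((Function.update p i (p i + τ))), fun v ↦ ∑ b ∈ (Finset.univ.erase j).filter (fun b ↦
    ((Function.update p i (p i + τ))) b = v), L b, ((Function.update p i (p i + τ))) j⟩ :
    Literature.Probability.LatticeModels.CollarLegModel.LegInsertionData) (V n) → 0 <
    (‖Literature.Probability.LatticeModels.CollarLegModel.Zins (V n) (⟨(Finset.univ.erase j).image (p), fun
    v ↦ ∑ b ∈ (Finset.univ.erase j).filter (fun b ↦ (p) b = v), L b, (p) j⟩ :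
    Literature.Probability.LatticeModels.CollarLegModel.LegInsertionData)‖ /
    ‖(Literature.Probability.LatticeModels.CollarLegModel.ofDomain (V n)).Z‖) → 0 <
    (‖Literature.Probability.LatticeModels.CollarLegModel.Zins (V n) (⟨(Finset.univ.erase j).image
    ((Function.update p i (p i + τ))), fun v ↦ ∑ b ∈ (Finset.univ.erase j).filter (fun b ↦ ((Function.update
    p i (p i + τ))) b = v), L b, ((Function.update p i (p i + τ))) j⟩ :
    Literature.Probability.LatticeModels.CollarLegModel.LegInsertionData)‖ /
    ‖(Literature.Probability.LatticeModels.CollarLegModel.ofDomain (V n)).Z‖) → (∀ i', (∃ d : ℤ × ℤ, (d =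
    (1, 0) ∨ d = (-1, 0) ∨ d = (0, 1) ∨ d = (0, -1)) ∧ ∀ v : ℤ × ℤ, (((((v).1 - (p i').1) ^ 2 + ((v).2 - (p
    i').2) ^ 2 : ℤ) : ℝ)) ≤ (r / δ n) ^ 2 → (v ∈ V n ↔ 0 ≤ (v.1 - (p i').1) * d.1 + (v.2 - (p i').2) *
    d.2))) → (∀ i₁ i₂ : Fin k, i₁ ≠ i₂ → (r / δ n) ^ 2 ≤ ((((((p) i₁).1 - ((p) i₂).1) ^ 2 + (((p) i₁).2 -
    ((p) i₂).2) ^ 2 : ℤ) : ℝ))) → |(Real.log (‖Literature.Probability.LatticeModels.CollarLegModel.Zins (V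
    n) (⟨(Finset.univ.erase j).image ((Function.update p i (p i + τ))), fun v ↦ ∑ b ∈ (Finset.univ.erase
    j).filter (fun b ↦ ((Function.update p i (p i + τ))) b = v), L b, ((Function.update p i (p i + τ))) j⟩ :
    Literature.Probability.LatticeModels.CollarLegModel.LegInsertionData)‖ /
    ‖(Literature.Probability.LatticeModels.CollarLegModel.ofDomain (V n)).Z‖) - (∑ i₁ : Fin k, ∑ i₂ ∈
    Finset.univ.filter (fun i₂ : Fin k ↦ i₁ < i₂), (-((if i₁ = j then (1 - (L j : ℝ)) else (L i₁ : ℝ)) * (if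
    i₂ = j then (1 - (L j : ℝ)) else (L i₂ : ℝ))) / 6) * Real.log
    (Literature.Probability.LatticeModels.dirichletGreen ((V n).image (fun v : ℤ × ℤ ↦ (![v.1, v.2] : Fin 2
    → ℤ))) (![(((Function.update p i (p i + τ))) i₁).1, (((Function.update p i (p i + τ))) i₁).2] : Fin 2 →
    ℤ) (![(((Function.update p i (p i + τ))) i₂).1, (((Function.update p i (p i + τ))) i₂).2] : Fin 2 →
    ℤ)))) - (Real.log (‖Literature.Probability.LatticeModels.CollarLegModel.Zins (V n) (⟨(Finset.univ.erase
    j).image (p), fun v ↦ ∑ b ∈ (Finset.univ.erase j).filter (fun b ↦ (p) b = v), L b, (p) j⟩ :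
    Literature.Probability.LatticeModels.CollarLegModel.LegInsertionData)‖ /
    ‖(Literature.Probability.LatticeModels.CollarLegModel.ofDomain (V n)).Z‖) - (∑ i₁ : Fin k, ∑ i₂ ∈
    Finset.univ.filter (fun i₂ : Fin k ↦ i₁ < i₂), (-((if i₁ = j then (1 - (L j : ℝ)) else (L i₁ : ℝ)) * (if
    i₂ = j then (1 - (L j : ℝ)) else (L i₂ : ℝ))) / 6) * Real.log
    (Literature.Probability.LatticeModels.dirichletGreen ((V n).image (fun v : ℤ × ℤ ↦ (![v.1, v.2] : Fin 2
    → ℤ))) (![((p) i₁).1, ((p) i₁).2] : Fin 2 → ℤ) (![((p) i₂).1, ((p) i₂).2] : Fin 2 → ℤ))))| ≤ ε * δ n) ∧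
    (∀ (D : Literature.Probability.RandomPlanarGeometry.JordanDomain), (∃ S : Finset (ℂ × ℂ), (∀ q ∈ S,
    q.1.re = q.2.re ∨ q.1.im = q.2.im) ∧ frontier D.carrier ⊆ ⋃ q ∈ S, segment ℝ q.1 q.2) → ∀ (r ε : ℝ), 0 <
    r → 0 < ε → ∃ ρ : ℝ, 0 < ρ ∧ ρ ≤ r ∧ ∀ (δ : ℕ → ℝ), (∀ n, 0 < δ n) → Filter.Tendsto δ Filter.atTop (nhds
    0) → ∀ (V : ℕ → Finset (ℤ × ℤ)), (∀ n, ∀ v : ℤ × ℤ, v ∈ V n ↔ (((v).1 : ℂ) * ((δ n : ℝ) : ℂ) + ((v).2 :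
    ℂ) * ((δ n : ℝ) : ℂ) * Complex.I) ∈ closure D.carrier) → ∀ᶠ n in Filter.atTop, ∀ (p : Fin k → ℤ × ℤ) (i
    : Fin k) (q : ℤ × ℤ), Function.Injective p → Function.Injective (Function.update p i q) →
    Literature.Probability.LatticeModels.CollarLegModel.LegInsertionData.IsAdmissible (⟨(Finset.univ.erase
    j).image (p), fun v ↦ ∑ b ∈ (Finset.univ.erase j).filter (fun b ↦ (p) b = v), L b, (p) j⟩ :
    Literature.Probability.LatticeModels.CollarLegModel.LegInsertionData) (V n) →
    Literature.Probability.LatticeModels.CollarLegModel.LegInsertionData.IsAdmissible (⟨(Finset.univ.erase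
    j).image ((Function.update p i q)), fun v ↦ ∑ b ∈ (Finset.univ.erase j).filter (fun b ↦
    ((Function.update p i q)) b = v), L b, ((Function.update p i q)) j⟩ :
    Literature.Probability.LatticeModels.CollarLegModel.LegInsertionData) (V n) → 0 <
    (‖Literature.Probability.LatticeModels.CollarLegModel.Zins (V n) (⟨(Finset.univ.erase j).image (p), fun
    v ↦ ∑ b ∈ (Finset.univ.erase j).filter (fun b ↦ (p) b = v), L b, (p) j⟩ :
    Literature.Probability.LatticeModels.CollarLegModel.LegInsertionData)‖ /
    ‖(Literature.Probability.LatticeModels.CollarLegModel.ofDomain (V n)).Z‖) → 0 <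
    (‖Literature.Probability.LatticeModels.CollarLegModel.Zins (V n) (⟨(Finset.univ.erase j).image
    ((Function.update p i q)), fun v ↦ ∑ b ∈ (Finset.univ.erase j).filter (fun b ↦ ((Function.update p i q))
    b = v), L b, ((Function.update p i q)) j⟩ :
    Literature.Probability.LatticeModels.CollarLegModel.LegInsertionData)‖ /
    ‖(Literature.Probability.LatticeModels.CollarLegModel.ofDomain (V n)).Z‖) → (∀ i', i' ≠ i → (∃ d : ℤ ×
    ℤ, (d = (1, 0) ∨ d = (-1, 0) ∨ d = (0, 1) ∨ d = (0, -1)) ∧ ∀ v : ℤ × ℤ, (((((v).1 - (p i').1) ^ 2 +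
    ((v).2 - (p i').2) ^ 2 : ℤ) : ℝ)) ≤ (r / δ n) ^ 2 → (v ∈ V n ↔ 0 ≤ (v.1 - (p i').1) * d.1 + (v.2 - (p
    i').2) * d.2))) → (∃ d : ℤ × ℤ, (d = (1, 0) ∨ d = (-1, 0) ∨ d = (0, 1) ∨ d = (0, -1)) ∧ ∀ v : ℤ × ℤ,
    (((((v).1 - (p i).1) ^ 2 + ((v).2 - (p i).2) ^ 2 : ℤ) : ℝ)) ≤ (ρ / 4 / δ n) ^ 2 → (v ∈ V n ↔ 0 ≤ (v.1 -
    (p i).1) * d.1 + (v.2 - (p i).2) * d.2)) → (∃ d : ℤ × ℤ, (d = (1, 0) ∨ d = (-1, 0) ∨ d = (0, 1) ∨ d =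
    (0, -1)) ∧ ∀ v : ℤ × ℤ, (((((v).1 - (q).1) ^ 2 + ((v).2 - (q).2) ^ 2 : ℤ) : ℝ)) ≤ (ρ / 4 / δ n) ^ 2 → (v
    ∈ V n ↔ 0 ≤ (v.1 - (q).1) * d.1 + (v.2 - (q).2) * d.2)) → (∀ i₁ i₂ : Fin k, i₁ ≠ i₂ → (r / δ n) ^ 2 ≤
    ((((((p) i₁).1 - ((p) i₂).1) ^ 2 + (((p) i₁).2 - ((p) i₂).2) ^ 2 : ℤ) : ℝ))) → (∀ i₁ i₂ : Fin k, i₁ ≠ i₂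
    → (r / δ n) ^ 2 ≤ (((((((Function.update p i q)) i₁).1 - (((Function.update p i q)) i₂).1) ^ 2 +
    ((((Function.update p i q)) i₁).2 - (((Function.update p i q)) i₂).2) ^ 2 : ℤ) : ℝ))) → (((((q).1 - (p
    i).1) ^ 2 + ((q).2 - (p i).2) ^ 2 : ℤ) : ℝ)) ≤ (ρ / δ n) ^ 2 → |(Real.log
    (‖Literature.Probability.LatticeModels.CollarLegModel.Zins (V n) (⟨(Finset.univ.erase j).image
    ((Function.update p i q)), fun v ↦ ∑ b ∈ (Finset.univ.erase j).filter (fun b ↦ ((Function.update p i q))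
    b = v), L b, ((Function.update p i q)) j⟩ :
    Literature.Probability.LatticeModels.CollarLegModel.LegInsertionData)‖ /
    ‖(Literature.Probability.LatticeModels.CollarLegModel.ofDomain (V n)).Z‖) - (∑ i₁ : Fin k, ∑ i₂ ∈
    Finset.univ.filter (fun i₂ : Fin k ↦ i₁ < i₂), (-((if i₁ = j then (1 - (L j : ℝ)) else (L i₁ : ℝ)) * (if
    i₂ = j then (1 - (L j : ℝ)) else (L i₂ : ℝ))) / 6) * Real.log
    (Literature.Probability.LatticeModels.dirichletGreen ((V n).image (fun v : ℤ × ℤ ↦ (![v.1, v.2] : Fin 2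
    → ℤ))) (![(((Function.update p i q)) i₁).1, (((Function.update p i q)) i₁).2] : Fin 2 → ℤ)
    (![(((Function.update p i q)) i₂).1, (((Function.update p i q)) i₂).2] : Fin 2 → ℤ)))) - (Real.log
    (‖Literature.Probability.LatticeModels.CollarLegModel.Zins (V n) (⟨(Finset.univ.erase j).image (p), fun
    v ↦ ∑ b ∈ (Finset.univ.erase j).filter (fun b ↦ (p) b = v), L b, (p) j⟩ :
    Literature.Probability.LatticeModels.CollarLegModel.LegInsertionData)‖ /
    ‖(Literature.Probability.LatticeModels.CollarLegModel.ofDomain (V n)).Z‖) - (∑ i₁ : Fin k, ∑ i₂ ∈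
    Finset.univ.filter (fun i₂ : Fin k ↦ i₁ < i₂), (-((if i₁ = j then (1 - (L j : ℝ)) else (L i₁ : ℝ)) * (if
    i₂ = j then (1 - (L j : ℝ)) else (L i₂ : ℝ))) / 6) * Real.log
    (Literature.Probability.LatticeModels.dirichletGreen ((V n).image (fun v : ℤ × ℤ ↦ (![v.1, v.2] : Fin 2
    → ℤ))) (![((p) i₁).1, ((p) i₁).2] : Fin 2 → ℤ) (![((p) i₂).1, ((p) i₂).2] : Fin 2 → ℤ))))| ≤ ε)) → (∀ ε
    : ℝ, 0 < ε → ∃ M : ℝ, 0 < M ∧ ∀ (V V' : Finset (ℤ × ℤ)) (a a' : ℤ × ℤ) (m : ℝ), 1 ≤ m → (∀ v : ℤ × ℤ,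
    (((((v).1 - (a).1) ^ 2 + ((v).2 - (a).2) ^ 2 : ℤ) : ℝ)) ≤ (M * m) ^ 2 → (v ∈ V ↔ 0 ≤ v.2 - (a).2)) → (∀
    v : ℤ × ℤ, (((((v).1 - (a').1) ^ 2 + ((v).2 - (a').2) ^ 2 : ℤ) : ℝ)) ≤ (M * m) ^ 2 → (v ∈ V' ↔ 0 ≤ v.2 -
    (a').2)) → ∀ (p : Fin k → ℤ × ℤ), Function.Injective p → (∀ i, (((((p i).1 - (a).1) ^ 2 + ((p i).2 -
    (a).2) ^ 2 : ℤ) : ℝ)) ≤ m ^ 2) →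
    Literature.Probability.LatticeModels.CollarLegModel.LegInsertionData.IsAdmissible (⟨(Finset.univ.erase
    j).image (p), fun v ↦ ∑ b ∈ (Finset.univ.erase j).filter (fun b ↦ (p) b = v), L b, (p) j⟩ :
    Literature.Probability.LatticeModels.CollarLegModel.LegInsertionData) (V) →
    Literature.Probability.LatticeModels.CollarLegModel.LegInsertionData.IsAdmissible (⟨(Finset.univ.erase
    j).image ((fun i ↦ p i - a + a')), fun v ↦ ∑ b ∈ (Finset.univ.erase j).filter (fun b ↦ ((fun i ↦ p i - a
    + a')) b = v), L b, ((fun i ↦ p i - a + a')) j⟩ :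
    Literature.Probability.LatticeModels.CollarLegModel.LegInsertionData) (V') → 0 <
    (‖Literature.Probability.LatticeModels.CollarLegModel.Zins (V) (⟨(Finset.univ.erase j).image (p), fun v
    ↦ ∑ b ∈ (Finset.univ.erase j).filter (fun b ↦ (p) b = v), L b, (p) j⟩ :
    Literature.Probability.LatticeModels.CollarLegModel.LegInsertionData)‖ /
    ‖(Literature.Probability.LatticeModels.CollarLegModel.ofDomain (V)).Z‖) → 0 <
    (‖Literature.Probability.LatticeModels.CollarLegModel.Zins (V') (⟨(Finset.univ.erase j).image ((fun i ↦
    p i - a + a')), fun v ↦ ∑ b ∈ (Finset.univ.erase j).filter (fun b ↦ ((fun i ↦ p i - a + a')) b = v), L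
    b, ((fun i ↦ p i - a + a')) j⟩ : Literature.Probability.LatticeModels.CollarLegModel.LegInsertionData)‖
    / ‖(Literature.Probability.LatticeModels.CollarLegModel.ofDomain (V')).Z‖) → |(Real.log
    (‖Literature.Probability.LatticeModels.CollarLegModel.Zins (V) (⟨(Finset.univ.erase j).image (p), fun v
    ↦ ∑ b ∈ (Finset.univ.erase j).filter (fun b ↦ (p) b = v), L b, (p) j⟩ :
    Literature.Probability.LatticeModels.CollarLegModel.LegInsertionData)‖ /
    ‖(Literature.Probability.LatticeModels.CollarLegModel.ofDomain (V)).Z‖) - (∑ i₁ : Fin k, ∑ i₂ ∈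
    Finset.univ.filter (fun i₂ : Fin k ↦ i₁ < i₂), (-((if i₁ = j then (1 - (L j : ℝ)) else (L i₁ : ℝ)) * (if
    i₂ = j then (1 - (L j : ℝ)) else (L i₂ : ℝ))) / 6) * Real.log
    (Literature.Probability.LatticeModels.dirichletGreen ((V).image (fun v : ℤ × ℤ ↦ (![v.1, v.2] : Fin 2 →
    ℤ))) (![((p) i₁).1, ((p) i₁).2] : Fin 2 → ℤ) (![((p) i₂).1, ((p) i₂).2] : Fin 2 → ℤ)))) - (Real.log
    (‖Literature.Probability.LatticeModels.CollarLegModel.Zins (V') (⟨(Finset.univ.erase j).image ((fun i ↦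
    p i - a + a')), fun v ↦ ∑ b ∈ (Finset.univ.erase j).filter (fun b ↦ ((fun i ↦ p i - a + a')) b = v), L
    b, ((fun i ↦ p i - a + a')) j⟩ : Literature.Probability.LatticeModels.CollarLegModel.LegInsertionData)‖
    / ‖(Literature.Probability.LatticeModels.CollarLegModel.ofDomain (V')).Z‖) - (∑ i₁ : Fin k, ∑ i₂ ∈
    Finset.univ.filter (fun i₂ : Fin k ↦ i₁ < i₂), (-((if i₁ = j then (1 - (L j : ℝ)) else (L i₁ : ℝ)) * (if
    i₂ = j then (1 - (L j : ℝ)) else (L i₂ : ℝ))) / 6) * Real.log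
    (Literature.Probability.LatticeModels.dirichletGreen ((V').image (fun v : ℤ × ℤ ↦ (![v.1, v.2] : Fin 2 →
    ℤ))) (![(((fun i ↦ p i - a + a')) i₁).1, (((fun i ↦ p i - a + a')) i₁).2] : Fin 2 → ℤ) (![(((fun i ↦ p i
    - a + a')) i₂).1, (((fun i ↦ p i - a + a')) i₂).2] : Fin 2 → ℤ))))| ≤ ε) → ∀ (D D' :
    Literature.Probability.RandomPlanarGeometry.MarkedDomain k), (∃ S : Finset (ℂ × ℂ), (∀ q ∈ S, q.1.re =
    q.2.re ∨ q.1.im = q.2.im) ∧ frontier D.carrier ⊆ ⋃ q ∈ S, segment ℝ q.1 q.2) → (∀ i, (∃ r : ℝ, 0 < r ∧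
    ((∀ z ∈ frontier D.carrier, dist z (D.pt i) < r → z.im = (D.pt i).im) ∨ (∀ z ∈ frontier D.carrier, dist
    z (D.pt i) < r → z.re = (D.pt i).re)))) → (∃ τ : ℂ, ‖τ‖ = 1 ∧ (∃ ε : ℝ, 0 < ε ∧ ∀ t ∈ Set.Ioo (D.mark j)
    (D.mark j + ε), ∃ s : ℝ, 0 < s ∧ D.boundary t = D.pt j + (s : ℂ) * τ) ∧ (∃ ε : ℝ, 0 < ε ∧ ∀ s ∈ Set.Ioo
    (0 : ℝ) ε, D.pt j + (s : ℂ) * (τ * Complex.I) ∈ D.carrier)) → (∃ S : Finset (ℂ × ℂ), (∀ q ∈ S, q.1.re =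
    q.2.re ∨ q.1.im = q.2.im) ∧ frontier D'.carrier ⊆ ⋃ q ∈ S, segment ℝ q.1 q.2) → (∀ i, (∃ r : ℝ, 0 < r ∧
    ((∀ z ∈ frontier D'.carrier, dist z (D'.pt i) < r → z.im = (D'.pt i).im) ∨ (∀ z ∈ frontier D'.carrier,
    dist z (D'.pt i) < r → z.re = (D'.pt i).re)))) → (∃ τ : ℂ, ‖τ‖ = 1 ∧ (∃ ε : ℝ, 0 < ε ∧ ∀ t ∈ Set.Ioo
    (D'.mark j) (D'.mark j + ε), ∃ s : ℝ, 0 < s ∧ D'.boundary t = D'.pt j + (s : ℂ) * τ) ∧ (∃ ε : ℝ, 0 < ε ∧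
    ∀ s ∈ Set.Ioo (0 : ℝ) ε, D'.pt j + (s : ℂ) * (τ * Complex.I) ∈ D'.carrier)) → ∀ (δ : ℕ → ℝ), (∀ n, 0 < δ
    n) → Filter.Tendsto δ Filter.atTop (nhds 0) → ∀ (V V' : ℕ → Finset (ℤ × ℤ)), (∀ n, ∀ v : ℤ × ℤ, v ∈ V n
    ↔ (((v).1 : ℂ) * ((δ n : ℝ) : ℂ) + ((v).2 : ℂ) * ((δ n : ℝ) : ℂ) * Complex.I) ∈ closure D.carrier) → (∀
    n, ∀ v : ℤ × ℤ, v ∈ V' n ↔ (((v).1 : ℂ) * ((δ n : ℝ) : ℂ) + ((v).2 : ℂ) * ((δ n : ℝ) : ℂ) * Complex.I) ∈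
    closure D'.carrier) → ∀ (p p' : ℕ → Fin k → ℤ × ℤ), (∀ n, Function.Injective ((p) n)) → (∀ n,
    Function.Injective ((p') n)) → (∀ i, Filter.Tendsto (fun n ↦ ((((p) n i).1 : ℂ) * ((δ n : ℝ) : ℂ) +
    (((p) n i).2 : ℂ) * ((δ n : ℝ) : ℂ) * Complex.I)) Filter.atTop (nhds (D.pt i))) → (∀ i, Filter.Tendsto
    (fun n ↦ ((((p') n i).1 : ℂ) * ((δ n : ℝ) : ℂ) + (((p') n i).2 : ℂ) * ((δ n : ℝ) : ℂ) * Complex.I))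
    Filter.atTop (nhds (D'.pt i))) → (∀ n,
    Literature.Probability.LatticeModels.CollarLegModel.LegInsertionData.IsAdmissible (⟨(Finset.univ.erase
    j).image ((p) n), fun v ↦ ∑ b ∈ (Finset.univ.erase j).filter (fun b ↦ ((p) n) b = v), L b, ((p) n) j⟩ :
    Literature.Probability.LatticeModels.CollarLegModel.LegInsertionData) (V n)) → (∀ n,
    Literature.Probability.LatticeModels.CollarLegModel.LegInsertionData.IsAdmissible (⟨(Finset.univ.erase
    j).image ((p') n), fun v ↦ ∑ b ∈ (Finset.univ.erase j).filter (fun b ↦ ((p') n) b = v), L b, ((p') n) j⟩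
    : Literature.Probability.LatticeModels.CollarLegModel.LegInsertionData) (V' n)) → (∀ᶠ n in Filter.atTop,
    0 < (‖Literature.Probability.LatticeModels.CollarLegModel.Zins (V n) (⟨(Finset.univ.erase j).image (p
    n), fun v ↦ ∑ b ∈ (Finset.univ.erase j).filter (fun b ↦ (p n) b = v), L b, (p n) j⟩ :
    Literature.Probability.LatticeModels.CollarLegModel.LegInsertionData)‖ /
    ‖(Literature.Probability.LatticeModels.CollarLegModel.ofDomain (V n)).Z‖)) ∧ Filter.Tendsto (fun n ↦
    (Real.log (‖Literature.Probability.LatticeModels.CollarLegModel.Zins (V n) (⟨(Finset.univ.erase j).image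
    (p n), fun v ↦ ∑ b ∈ (Finset.univ.erase j).filter (fun b ↦ (p n) b = v), L b, (p n) j⟩ :
    Literature.Probability.LatticeModels.CollarLegModel.LegInsertionData)‖ /
    ‖(Literature.Probability.LatticeModels.CollarLegModel.ofDomain (V n)).Z‖) - (∑ i₁ : Fin k, ∑ i₂ ∈
    Finset.univ.filter (fun i₂ : Fin k ↦ i₁ < i₂), (-((if i₁ = j then (1 - (L j : ℝ)) else (L i₁ : ℝ)) * (if
    i₂ = j then (1 - (L j : ℝ)) else (L i₂ : ℝ))) / 6) * Real.log
    (Literature.Probability.LatticeModels.dirichletGreen ((V n).image (fun v : ℤ × ℤ ↦ (![v.1, v.2] : Fin 2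
    → ℤ))) (![((p n) i₁).1, ((p n) i₁).2] : Fin 2 → ℤ) (![((p n) i₂).1, ((p n) i₂).2] : Fin 2 → ℤ)))) -
    (Real.log (‖Literature.Probability.LatticeModels.CollarLegModel.Zins (V' n) (⟨(Finset.univ.erase
    j).image (p' n), fun v ↦ ∑ b ∈ (Finset.univ.erase j).filter (fun b ↦ (p' n) b = v), L b, (p' n) j⟩ :
    Literature.Probability.LatticeModels.CollarLegModel.LegInsertionData)‖ /
    ‖(Literature.Probability.LatticeModels.CollarLegModel.ofDomain (V' n)).Z‖) - (∑ i₁ : Fin k, ∑ i₂ ∈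
    Finset.univ.filter (fun i₂ : Fin k ↦ i₁ < i₂), (-((if i₁ = j then (1 - (L j : ℝ)) else (L i₁ : ℝ)) * (if
    i₂ = j then (1 - (L j : ℝ)) else (L i₂ : ℝ))) / 6) * Real.log
    (Literature.Probability.LatticeModels.dirichletGreen ((V' n).image (fun v : ℤ × ℤ ↦ (![v.1, v.2] : Fin 2
    → ℤ))) (![((p' n) i₁).1, ((p' n) i₁).2] : Fin 2 → ℤ) (![((p' n) i₂).1, ((p' n) i₂).2] : Fin 2 → ℤ)))))
    Filter.atTop (nhds 0) := by
  intro k L j _hL hT hR hPT hCL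
  exact s3_rigidityAbstract
    (fun (W : Finset (ℤ × ℤ)) (c : Fin k → ℤ × ℤ) ↦
    Literature.Probability.LatticeModels.CollarLegModel.LegInsertionData.IsAdmissible (⟨(Finset.univ.erase
    j).image (c), fun v ↦ ∑ b ∈ (Finset.univ.erase j).filter (fun b ↦ (c) b = v), L b, (c) j⟩ :
    Literature.Probability.LatticeModels.CollarLegModel.LegInsertionData) (W))
    (fun (W : Finset (ℤ × ℤ)) (c : Fin k → ℤ × ℤ) ↦
    (‖Literature.Probability.LatticeModels.CollarLegModel.Zins (W) (⟨(Finset.univ.erase j).image (c), fun v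
    ↦ ∑ b ∈ (Finset.univ.erase j).filter (fun b ↦ (c) b = v), L b, (c) j⟩ :
    Literature.Probability.LatticeModels.CollarLegModel.LegInsertionData)‖ /
    ‖(Literature.Probability.LatticeModels.CollarLegModel.ofDomain (W)).Z‖))
    (fun (W : Finset (ℤ × ℤ)) (c : Fin k → ℤ × ℤ) ↦ (Real.log
    (‖Literature.Probability.LatticeModels.CollarLegModel.Zins (W) (⟨(Finset.univ.erase j).image (c), fun v
    ↦ ∑ b ∈ (Finset.univ.erase j).filter (fun b ↦ (c) b = v), L b, (c) j⟩ :
    Literature.Probability.LatticeModels.CollarLegModel.LegInsertionData)‖ /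
    ‖(Literature.Probability.LatticeModels.CollarLegModel.ofDomain (W)).Z‖) - (∑ i₁ : Fin k, ∑ i₂ ∈
    Finset.univ.filter (fun i₂ : Fin k ↦ i₁ < i₂), (-((if i₁ = j then (1 - (L j : ℝ)) else (L i₁ : ℝ)) * (if
    i₂ = j then (1 - (L j : ℝ)) else (L i₂ : ℝ))) / 6) * Real.log
    (Literature.Probability.LatticeModels.dirichletGreen ((W).image (fun v : ℤ × ℤ ↦ (![v.1, v.2] : Fin 2 →
    ℤ))) (![((c) i₁).1, ((c) i₁).2] : Fin 2 → ℤ) (![((c) i₂).1, ((c) i₂).2] : Fin 2 → ℤ)))))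
    (fun (D : Literature.Probability.RandomPlanarGeometry.JordanDomain) ↦ ∃ S : Finset (ℂ × ℂ), (∀ q ∈ S,
    q.1.re = q.2.re ∨ q.1.im = q.2.im) ∧ frontier D.carrier ⊆ ⋃ q ∈ S, segment ℝ q.1 q.2)
    (fun (D : Literature.Probability.RandomPlanarGeometry.MarkedDomain k) ↦ ∀ i, (∃ r : ℝ, 0 < r ∧ ((∀ z ∈
    frontier D.carrier, dist z (D.pt i) < r → z.im = (D.pt i).im) ∨ (∀ z ∈ frontier D.carrier, dist z (D.pt
    i) < r → z.re = (D.pt i).re))))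
    (fun (D : Literature.Probability.RandomPlanarGeometry.MarkedDomain k) ↦ ∃ τ : ℂ, ‖τ‖ = 1 ∧ (∃ ε : ℝ, 0 <
    ε ∧ ∀ t ∈ Set.Ioo (D.mark j) (D.mark j + ε), ∃ s : ℝ, 0 < s ∧ D.boundary t = D.pt j + (s : ℂ) * τ) ∧ (∃
    ε : ℝ, 0 < ε ∧ ∀ s ∈ Set.Ioo (0 : ℝ) ε, D.pt j + (s : ℂ) * (τ * Complex.I) ∈ D.carrier))
    (fun (D : Literature.Probability.RandomPlanarGeometry.JordanDomain) (δ : ℕ → ℝ) (V : ℕ → Finset (ℤ × ℤ))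
    ↦ ∀ n, ∀ v : ℤ × ℤ, v ∈ V n ↔ (((v).1 : ℂ) * ((δ n : ℝ) : ℂ) + ((v).2 : ℂ) * ((δ n : ℝ) : ℂ) *
    Complex.I) ∈ closure D.carrier)
    (fun (D : Literature.Probability.RandomPlanarGeometry.MarkedDomain k) (δ : ℕ → ℝ) (p : ℕ → Fin k → ℤ ×
    ℤ) ↦ ∀ i, Filter.Tendsto (fun n ↦ ((((p) n i).1 : ℂ) * ((δ n : ℝ) : ℂ) + (((p) n i).2 : ℂ) * ((δ n : ℝ)
    : ℂ) * Complex.I)) Filter.atTop (nhds (D.pt i)))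
    hT hR hPT hCL

open Literature.Probability.LatticeModels Literature.Probability.LatticeModels.CollarLegModel in
/-- **Each boundary step moves at most one unit in each coordinate.** Hence `g` steps of the
boundary walk move the vertex by at most `g` in each coordinate: index gaps along the boundary
cycle are bounded below by the `ℓ∞`-distance of the vertices. [folklore] -/
theorem s3_dsucc_iterate_dist :
    ∀ (V : Finset (ℤ × ℤ)) (d : Literature.Probability.LatticeModels.CollarLegModel.Dart) (g : ℕ),
    |((Literature.Probability.LatticeModels.CollarLegModel.dsucc V)^[g] d).1.1 - d.1.1| ≤ g ∧
    |((Literature.Probability.LatticeModels.CollarLegModel.dsucc V)^[g] d).1.2 - d.1.2| ≤ g := by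
  intro V
  have hstep : ∀ d : Dart, |(dsucc V d).1.1 - d.1.1| ≤ 1 ∧ |(dsucc V d).1.2 - d.1.2| ≤ 1 := by
    rintro ⟨⟨a, b⟩, k⟩
    have hd1 : ∀ k : Fin 4, |(dir k).1| ≤ 1 ∧ |(dir k).2| ≤ 1 := by decide
    have hd2 : ∀ k : Fin 4, |(dir (k + 1) + dir k).1| ≤ 1 ∧ |(dir (k + 1) + dir k).2| ≤ 1 := by decide
    by_cases hA : ((a, b) : ℤ × ℤ) + dir (k + 1) ∈ V
    · by_cases hB : ((a, b) : ℤ × ℤ) + dir (k + 1) + dir k ∈ V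
      · have hds : dsucc V ((a, b), k) = ((a, b) + dir (k + 1) + dir k, k + 3) := by
          simp [dsucc, hA, hB]
        rw [hds]
        constructor
        · have e : ((a, b) + dir (k + 1) + dir k, k + 3).1.1 - (((a, b), k) : Dart).1.1 =
              (dir (k + 1) + dir k).1 := by simp only [Prod.fst_add]; ring
          rw [e]; exact (hd2 k).1
        · have e : ((a, b) + dir (k + 1) + dir k, k + 3).1.2 - (((a, b), k) : Dart).1.2 =
              (dir (k + 1) + dir k).2 := by simp only [Prod.snd_add]; ring
          rw [e]; exact (hd2 k).2
      · have hds : dsucc V ((a, b), k) = ((a, b) + dir (k + 1), k) := by simp [dsucc, hA, hB]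
        rw [hds]
        constructor
        · have e : ((a, b) + dir (k + 1), k).1.1 - (((a, b), k) : Dart).1.1 = (dir (k + 1)).1 := by
            simp only [Prod.fst_add]; ring
          rw [e]; exact (hd1 (k + 1)).1
        · have e : ((a, b) + dir (k + 1), k).1.2 - (((a, b), k) : Dart).1.2 = (dir (k + 1)).2 := by
            simp only [Prod.snd_add]; ring
          rw [e]; exact (hd1 (k + 1)).2
    · have hds : dsucc V ((a, b), k) = ((a, b), k + 1) := by simp [dsucc, hA]
      rw [hds]
      simp
  intro d g
  induction g with
  | zero => simp
  | succ g ih =>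
    rw [Function.iterate_succ_apply']
    obtain ⟨h1, h2⟩ := hstep ((dsucc V)^[g] d)
    constructor
    · have := abs_add_le (((dsucc V) ((dsucc V)^[g] d)).1.1 - ((dsucc V)^[g] d).1.1)
        (((dsucc V)^[g] d).1.1 - d.1.1)
      rw [sub_add_sub_cancel] at this
      push_cast
      linarith [ih.1]
    · have := abs_add_le (((dsucc V) ((dsucc V)^[g] d)).1.2 - ((dsucc V)^[g] d).1.2)
        (((dsucc V)^[g] d).1.2 - d.1.2)
      rw [sub_add_sub_cancel] at this
      push_cast
      linarith [ih.2]

end Summit.CriticalPhenomena.CardyFormulaZ2.Cruxes.BoundaryDefectGaussianR.RainbowMonomialsInExcursionKernels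

end
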